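import Mathlib
import Summits.ResolutionOfSingularities.ResolutionOfSingularities.Theorems.RadicialJungCleanModelsContactChainContaining
import HarnessLib

/-!
# Route `RadicialJung`, crux `CleanModels` (stmt-ResolutionOfSingularities-15917), line `Sketch` rev 35, stub 6 `stub_cleanProp44` (X44c),
# work plan O8 / L7b: a representative vanishing SIMPLY on the curve generically becomes a regular parameter containing the strict transform

Memo `Cruxes/CleanModels/Lines/Sketch-memo-hand2-g8-stubs-5-7.md` §2 (T2a).  Setting as in `…ContactChainContaining.lean` (✓ p812266): `X₀` regular
locally Noetherian, `C₀` a regular curve through `x₀` (`dim 𝒪_{X₀,x₀} = 3`), `(t₁,t₂)` an rsop pair generating `𝓘_{C₀,x₀}`, `w` a transversal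
coordinate.  An element `R ∈ 𝓘_{C₀,x₀}` which is SIMPLE along `C₀` generically (its image in `𝓘/𝓘² ≅ 𝒪_{C₀,x₀}²` is non-zero) has the normal form
`R = Σ_i (w^j μ_i + π_i)·t_i` with some `μ_i` a unit and `π_i ∈ 𝓘_{C₀,x₀}` (`j` = the order along `C₀` of that image); `j = 0` says that `R` is a
regular parameter IN `𝓘_{C₀,x₀}`.  Along a chain of point blowing ups following the curve: each step with `j − n ≥ 1` divides `R` by `e²`
(`𝔪·𝓘_C·𝒪' = e²·𝓘_{C̃}`) and lowers the residual order by one; past `j` the element has joined the containing pair and is divided by `e` per step.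

* `simpleContaining_pair_along_pointChain` — along `IsPointChainAlong σ C₀ C x n`: ONE exceptional coordinate `e`, the transversal family
  `σ^#(γ_i w^{k_i} + s₀ᵢ) = c_i e^{min(n,k_i)}(γ_i' e^{k_i−n} + π_i')`, the transformed pair `(t₁⁽ⁿ⁾,t₂⁽ⁿ⁾)` (rsop, generating `𝓘_{C,x}`,
  `σ^#t_i = c_i e^n t_i⁽ⁿ⁾`), and
  `σ^#R = c · e^{2 min(n,j) + (n − j)} · Σ_i (e^{j−n} μ_i' + π_i')·t_i⁽ⁿ⁾` with `μ_i'` a unit whenever `μ_i` is and `π_i' ∈ 𝓘_{C,x}`.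
* `span_pair_eq_of_unit_coeff` — at `j ≤ n`: `R⁽ⁿ⁾ := Σ_i (μ_i' + π_i') t_i⁽ⁿ⁾` with `μ_{i₀}'` a unit satisfies `(R⁽ⁿ⁾, t_{1−i₀}⁽ⁿ⁾) = 𝓘_{C,x}`, and the
  pair is part of a regular system of parameters (`isRsopPart_of_span_eq_span`): `R` HAS BECOME A CLEAN COMPONENT CONTAINING THE CURVE, so a
  representative `u₀ · R^a · ∏_i (γ_i w^{k_i} + s₀ᵢ)^{b_i}` with `p ∤ a` is clean-permissible for the strict transform at the end point of ANY
  chain of length `n ≥ j`, `n ≥ max_i k_i` (no charge condition): `cleanPermissibleAt_of_pointChain_simpleContaining` (the transversal family is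
  carried along the SAME chain, so that everything is expressed in the one coordinate `e`; final step ✓ `cleanPermissibleAt_of_split`).

Honest framing: OURS (elementary local algebra of point blowing ups); nothing here proves resolution in characteristic `p`, X44c, or any case of
`CleanModels`; sub-case (T2b) of the memo (representatives vanishing to order `≥ 2` along the curve) is NOT treated.
-/

noncomputable section

set_option linter.dupNamespace false -- mandated namespace of this single-conjunct summit

open CategoryTheory AlgebraicGeometry TopologicalSpace IsLocalRing
open Literature.AlgebraicGeometry.Resolution Literature.AlgebraicGeometry.Motives
open Scheme.IdealSheafData

universe u

namespace Summit.ResolutionOfSingularities.ResolutionOfSingularities.Theorems.RadicialJung.CleanModels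

/-- An element of the ideal generated by a pair is a combination of the pair (`Ideal.mem_span_pair`, for a `Fin 2`-indexed family). [folklore] -/
theorem exists_eq_combination_of_mem_span_pair {R : Type u} [CommRing R] {t : Fin 2 → R} {π : R}
    (h : π ∈ Ideal.span (Set.range t)) : ∃ α β : R, π = α * t 0 + β * t 1 := by
  have hr : Set.range t = {t 0, t 1} := by
    ext y
    simp only [Set.mem_range, Set.mem_insert_iff, Set.mem_singleton_iff]
    constructor
    · rintro ⟨i, rfl⟩; fin_cases i <;> simp
    · rintro (rfl | rfl); exacts [⟨0, rfl⟩, ⟨1, rfl⟩]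
  rw [hr, Ideal.mem_span_pair] at h
  obtain ⟨α, β, h⟩ := h
  exact ⟨α, β, h.symm⟩

/-- **A simple containing representative along one chain of point blowing ups.**  See the module docstring.
[cite: CossartJannsenSaito2020, proof of Thm. 6.28, Step 5] [cite: CossartPiltant2008, Prop. 4.4 (proof, p. 10)] -/
theorem simpleContaining_pair_along_pointChain {X₀ X : Scheme.{u}} {σ : X ⟶ X₀} {C₀ : Closeds X₀} {C : Closeds X} {x : X} {n : ℕ}
    (h : IsPointChainAlong σ C₀ C x n) [IsLocallyNoetherian X₀] [IsLocallyNoetherian X] (hX₀ : Scheme.IsRegular X₀)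
    (hC₀reg : ∀ y ∈ (C₀ : Set X₀), ∃ c : Fin 2 → X₀.presheaf.stalk y,
      IsRsopPart c ∧ Ideal.span (Set.range c) = stalkIdeal (vanishingIdeal C₀) y)
    (hxC₀ : σ x ∈ (C₀ : Set X₀)) (hdim₀ : ringKrullDim (X₀.presheaf.stalk (σ x)) = 3)
    (w : X₀.presheaf.stalk (σ x)) (hw : stalkIdeal (vanishingIdeal C₀) (σ x) ⊔ Ideal.span {w} = maximalIdeal _)
    (t : Fin 2 → X₀.presheaf.stalk (σ x)) (ht : IsRsopPart t)
    (htP : Ideal.span (Set.range t) = stalkIdeal (vanishingIdeal C₀) (σ x))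
    (j : ℕ) (μ π : Fin 2 → X₀.presheaf.stalk (σ x)) (hπ : ∀ i, π i ∈ stalkIdeal (vanishingIdeal C₀) (σ x))
    {m : ℕ} (γ s₀ : Fin m → X₀.presheaf.stalk (σ x)) (hγ : ∀ i, IsUnit (γ i))
    (hs₀ : ∀ i, s₀ i ∈ stalkIdeal (vanishingIdeal C₀) (σ x)) (k : Fin m → ℕ) :
    Scheme.IsRegular X ∧
    (∀ y ∈ (C : Set X), ∃ c : Fin 2 → X.presheaf.stalk y, IsRsopPart c ∧ Ideal.span (Set.range c) = stalkIdeal (vanishingIdeal C) y) ∧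
    x ∈ (C : Set X) ∧ ringKrullDim (X.presheaf.stalk x) = 3 ∧
    ∃ e : X.presheaf.stalk x, stalkIdeal (vanishingIdeal C) x ⊔ Ideal.span {e} = maximalIdeal _ ∧
      (∀ i, ∃ (c γ' π' : X.presheaf.stalk x), IsUnit c ∧ IsUnit γ' ∧ π' ∈ stalkIdeal (vanishingIdeal C) x ∧
        (σ.stalkMap x).hom (γ i * w ^ k i + s₀ i) = c * e ^ min n (k i) * (γ' * e ^ (k i - n) + π')) ∧
      ∃ tn : Fin 2 → X.presheaf.stalk x, IsRsopPart tn ∧ Ideal.span (Set.range tn) = stalkIdeal (vanishingIdeal C) x ∧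
        (∀ i, ∃ c : X.presheaf.stalk x, IsUnit c ∧ (σ.stalkMap x).hom (t i) = c * e ^ n * tn i) ∧
        ∃ (c : X.presheaf.stalk x) (μ' π' : Fin 2 → X.presheaf.stalk x), IsUnit c ∧ (∀ i, IsUnit (μ i) → IsUnit (μ' i)) ∧
          (∀ i, π' i ∈ stalkIdeal (vanishingIdeal C) x) ∧
          (σ.stalkMap x).hom (∑ i, (w ^ j * μ i + π i) * t i) =
            c * e ^ (2 * min n j + (n - j)) * ∑ i, (e ^ (j - n) * μ' i + π' i) * tn i := by
  induction h with
  | nil C₀ x₀ =>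
    refine ⟨hX₀, hC₀reg, hxC₀, hdim₀, w, hw, fun i => ⟨1, γ i, s₀ i, isUnit_one, hγ i, hs₀ i, ?_⟩, t, ht, htP,
      fun i => ⟨1, isUnit_one, ?_⟩, 1, μ, π, isUnit_one, fun i hi => hi, hπ, ?_⟩
    · rw [Scheme.Hom.stalkMap_id]
      simp only [Nat.zero_min, pow_zero, one_mul, Nat.sub_zero]
      rfl
    · rw [Scheme.Hom.stalkMap_id]
      simp only [pow_zero, one_mul]
      rfl
    · rw [Scheme.Hom.stalkMap_id]
      simp only [Nat.zero_min, mul_zero, Nat.zero_sub, zero_add, pow_zero, one_mul, Nat.sub_zero]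
      rfl
  | @cons X X' _ _ σ C₀ C n τ x' hx hchain hYreg hτ hx' ih =>
    obtain ⟨hX, hCreg, hxC, hdim, e, he, hfam, tI, htI, htIP, htimg, c, μ', π', hc, hμ', hπ', hRimg⟩ :=
      ih hC₀reg hxC₀ hdim₀ w hw t ht htP μ π hπ γ s₀ hγ hs₀
    have hPle : stalkIdeal (vanishingIdeal C) (τ x') ≤ maximalIdeal _ := le_sup_left.trans he.le
    obtain ⟨hX', hC'reg, hdim'⟩ := strictTransform_curve_data_of_isBlowup_point hX hx hYreg hτ hCreg hxC hdim hx'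
    haveI : IsRegularLocalRing (X'.presheaf.stalk x') := hX' x'
    -- ONE new exceptional coordinate `e'` at `x'`, with `τ^#(e) = v₁ e'`
    obtain ⟨e', he'gen, htr', γ₁, hγ₁, v₁, hv₁, π₁, hπ₁, -, h2⟩ :=
      contact_drop_of_isBlowup_point hX hx hYreg hτ hCreg hxC hdim hx' e 1 1 0 he isUnit_one (Ideal.zero_mem _) 1 le_rfl 1 0
    have heimg : (τ.stalkMap x').hom e = v₁ * e' := by
      simpa using h2
    -- the containing pair, aligned to `e'`
    obtain ⟨e₃, he₃gen, t', ht', ht'P, ht'img⟩ := containing_pair_step hX hx hYreg hτ hCreg hxC hdim hx' tI htIP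
    haveI := isDomain_of_isRegularLocalRing (X'.presheaf.stalk x')
    obtain ⟨u3, hu3⟩ := (Ideal.span_singleton_eq_span_singleton.mp (he₃gen.symm.trans he'gen)).symm
    set d : X'.presheaf.stalk x' := (u3 : X'.presheaf.stalk x') with hd_def
    have hd : IsUnit d := u3.isUnit
    have hde : e₃ = d * e' := by rw [hd_def, ← hu3, mul_comm]
    have hspan_d : Ideal.span (Set.range fun i => d * t' i) = Ideal.span (Set.range t') := by
      apply le_antisymm
      · exact Ideal.span_le.mpr (by rintro _ ⟨i, rfl⟩; exact Ideal.mul_mem_left _ _ (Ideal.subset_span ⟨i, rfl⟩))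
      · refine Ideal.span_le.mpr ?_
        rintro _ ⟨i, rfl⟩
        have : t' i = ↑(hd.unit⁻¹) * (d * t' i) := by
          rw [← mul_assoc, IsUnit.val_inv_mul, one_mul]
        rw [this]
        exact Ideal.mul_mem_left _ _ (Ideal.subset_span ⟨i, rfl⟩)
    have htn'P : Ideal.span (Set.range fun i => d * t' i) = stalkIdeal (vanishingIdeal _) x' := hspan_d.trans ht'P
    -- images of the old curve-ideal elements `π' i`: `τ^#(π' i) = e' · π'' i` with `π'' i ∈ 𝓘_{C̃,x'}`
    have hπimg : ∀ i, ∃ π'' : X'.presheaf.stalk x', π'' ∈ stalkIdeal (vanishingIdeal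
        (⟨closure (τ ⁻¹' ((C : Set X) \ {τ x'})), isClosed_closure⟩ : Closeds X')) x' ∧ (τ.stalkMap x').hom (π' i) = e' * π'' := by
      intro i
      obtain ⟨α, β, hαβ⟩ := exists_eq_combination_of_mem_span_pair (t := tI) (by rw [htIP]; exact hπ' i)
      refine ⟨(τ.stalkMap x').hom α * (d * t' 0) + (τ.stalkMap x').hom β * (d * t' 1), ?_, ?_⟩
      · rw [← htn'P]
        exact Ideal.add_mem _ (Ideal.mul_mem_left _ _ (Ideal.subset_span ⟨0, rfl⟩))
          (Ideal.mul_mem_left _ _ (Ideal.subset_span ⟨1, rfl⟩))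
      · rw [hαβ, map_add, map_mul, map_mul, ht'img 0, ht'img 1, hde]
        ring
    choose π'' hπ''P hπ''img using hπimg
    refine ⟨hX', hC'reg, hx', hdim', e', htr', fun i => ?_, fun i => d * t' i, isRsopPart_of_span_eq_span ht' ht'P htn'P, htn'P,
      fun i => ?_, ?_⟩
    · -- the transversal family (verbatim from `contact_family_pair_along_pointChain`)
      obtain ⟨cI, γ', πI, hcI, hγ', hπI, hsimg⟩ := hfam i
      have hsimg' : (σ.stalkMap (τ x')).hom (γ i * w ^ k i + s₀ i) = cI * e ^ min n (k i) * (γ' * e ^ (k i - n) + πI) := hsimg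
      by_cases hnk : n < k i
      · have hk1 : 1 ≤ k i - n := by omega
        obtain ⟨e₂, he₂gen, -, γ₂, hγ₂, v₂, -, π₂, hπ₂, h1, -⟩ :=
          contact_drop_of_isBlowup_point hX hx hYreg hτ hCreg hxC hdim hx' e γ' 1 πI he hγ' hπI (k i - n) hk1 1 0
        obtain ⟨u2, hu2⟩ := (Ideal.span_singleton_eq_span_singleton.mp (he₂gen.symm.trans he'gen)).symm
        have hd2 : IsUnit (u2 : X'.presheaf.stalk x') := u2.isUnit
        have hde2 : e₂ = (u2 : X'.presheaf.stalk x') * e' := by rw [← hu2, mul_comm]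
        have hmin : min n (k i) = n := Nat.min_eq_left hnk.le
        have hmin' : min (n + 1) (k i) = n + 1 := Nat.min_eq_left (by omega)
        refine ⟨(τ.stalkMap x').hom cI * v₁ ^ n * u2, γ₂ * (u2 : X'.presheaf.stalk x') ^ (k i - n - 1), π₂,
          ((hcI.map _).mul (hv₁.pow n)).mul hd2, hγ₂.mul (hd2.pow _), hπ₂, ?_⟩
        rw [Scheme.Hom.stalkMap_comp]
        change (τ.stalkMap x').hom ((σ.stalkMap (τ x')).hom (γ i * w ^ k i + s₀ i)) = _
        rw [hsimg', map_mul, map_mul, map_pow, heimg, h1, hde2, hmin, hmin', show k i - (n + 1) = k i - n - 1 by omega]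
        have hsplit : ((u2 : X'.presheaf.stalk x') * e') ^ (k i - n - 1) =
            (u2 : X'.presheaf.stalk x') ^ (k i - n - 1) * e' ^ (k i - n - 1) := mul_pow _ _ _
        rw [hsplit]
        ring
      · have hkn : k i ≤ n := Nat.le_of_not_lt hnk
        have hmin : min n (k i) = k i := Nat.min_eq_right hkn
        have hmin' : min (n + 1) (k i) = k i := Nat.min_eq_right (by omega)
        have hsub : k i - n = 0 := Nat.sub_eq_zero_of_le hkn
        have hsub' : k i - (n + 1) = 0 := Nat.sub_eq_zero_of_le (by omega)
        have hunit : IsUnit (γ' + πI) := by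
          by_contra hnu
          have hm : γ' + πI ∈ maximalIdeal (X.presheaf.stalk (τ x')) := (mem_maximalIdeal _).mpr hnu
          have h2' : γ' + πI - πI ∈ maximalIdeal (X.presheaf.stalk (τ x')) := Ideal.sub_mem _ hm (hPle hπI)
          rw [add_sub_cancel_right] at h2'
          exact (mem_maximalIdeal _).mp h2' hγ'
        refine ⟨(τ.stalkMap x').hom cI * v₁ ^ k i, (τ.stalkMap x').hom (γ' + πI), 0,
          (hcI.map _).mul (hv₁.pow _), hunit.map _, Ideal.zero_mem _, ?_⟩
        rw [Scheme.Hom.stalkMap_comp]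
        change (τ.stalkMap x').hom ((σ.stalkMap (τ x')).hom (γ i * w ^ k i + s₀ i)) = _
        rw [hsimg', hmin, hsub, hmin', hsub', pow_zero, mul_one, pow_zero, mul_one, add_zero, map_mul, map_mul, map_pow, heimg,
          mul_pow]
        ring
    · obtain ⟨ci, hci, hcimg⟩ := htimg i
      have hcimg' : (σ.stalkMap (τ x')).hom (t i) = ci * e ^ n * tI i := hcimg
      refine ⟨(τ.stalkMap x').hom ci * v₁ ^ n, (hci.map _).mul (hv₁.pow n), ?_⟩
      rw [Scheme.Hom.stalkMap_comp]
      change (τ.stalkMap x').hom ((σ.stalkMap (τ x')).hom (t i)) = _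
      rw [hcimg', map_mul, map_mul, map_pow, heimg, ht'img i, hde, mul_pow]
      ring
    · have hRimg' : (σ.stalkMap (τ x')).hom (∑ i, (w ^ j * μ i + π i) * t i) =
          c * e ^ (2 * min n j + (n - j)) * ∑ i, (e ^ (j - n) * μ' i + π' i) * tI i := hRimg
      by_cases hnj : n < j
      · -- before saturation: divide by `e'²`, the residual order drops by one
        have hmin : min n j = n := Nat.min_eq_left hnj.le
        have hmin' : min (n + 1) j = n + 1 := Nat.min_eq_left (by omega)
        have hsub : n - j = 0 := Nat.sub_eq_zero_of_le hnj.le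
        have hsub' : n + 1 - j = 0 := Nat.sub_eq_zero_of_le (by omega)
        have hjn : j - n = (j - (n + 1)) + 1 := by omega
        refine ⟨(τ.stalkMap x').hom c * v₁ ^ (2 * n), fun i => v₁ ^ (j - n) * (τ.stalkMap x').hom (μ' i),
          fun i => π'' i, (hc.map _).mul (hv₁.pow _), fun i hi => (hv₁.pow _).mul ((hμ' i hi).map _), hπ''P, ?_⟩
        rw [Scheme.Hom.stalkMap_comp]
        change (τ.stalkMap x').hom ((σ.stalkMap (τ x')).hom (∑ i, (w ^ j * μ i + π i) * t i)) = _
        rw [hRimg', map_mul, map_mul, map_pow, heimg, map_sum, hmin, hsub, hmin', hsub']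
        simp only [map_mul, map_add, map_pow, heimg, hπ''img, ht'img, hde, Fin.sum_univ_two]
        rw [hjn]
        ring
      · -- past saturation: `R` has joined the containing pair and is divided by `e'` once per step
        have hjn : j ≤ n := Nat.le_of_not_lt hnj
        have hmin : min n j = j := Nat.min_eq_right hjn
        have hmin' : min (n + 1) j = j := Nat.min_eq_right (by omega)
        have hsub : j - n = 0 := Nat.sub_eq_zero_of_le hjn
        have hsub' : j - (n + 1) = 0 := Nat.sub_eq_zero_of_le (by omega)
        have hexp : 2 * j + (n + 1 - j) = 2 * j + (n - j) + 1 := by omega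
        refine ⟨(τ.stalkMap x').hom c * v₁ ^ (2 * j + (n - j)), fun i => (τ.stalkMap x').hom (μ' i),
          fun i => e' * π'' i, (hc.map _).mul (hv₁.pow _), fun i hi => (hμ' i hi).map _,
          fun i => Ideal.mul_mem_left _ _ (hπ''P i), ?_⟩
        rw [Scheme.Hom.stalkMap_comp]
        change (τ.stalkMap x').hom ((σ.stalkMap (τ x')).hom (∑ i, (w ^ j * μ i + π i) * t i)) = _
        rw [hRimg', map_mul, map_mul, map_pow, heimg, map_sum, hmin, hsub, hmin', hsub', hexp]
        simp only [map_mul, map_add, hπ''img, ht'img, hde, Fin.sum_univ_two, pow_zero, one_mul]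
        ring

/-- **At saturation the representative is a regular parameter containing the curve**: if `R = Σ_i (μ_i + π_i)·t_i` with `(t₁,t₂)` a pair,
part of a regular system of parameters, generating `P`, `π_i ∈ P` and `μ_{i₀}` a unit, then `(R, t_{i₁})` (`i₁ ≠ i₀`) generates `P` and is part of a
regular system of parameters. [cite: Matsumura1987, Thm. 14.2] -/
theorem span_pair_eq_of_unit_coeff {A : Type u} [CommRing A] [IsLocalRing A] {t : Fin 2 → A} (ht : IsRsopPart t) {P : Ideal A}
    (htP : Ideal.span (Set.range t) = P) (hPm : P ≤ maximalIdeal A) (μ π : Fin 2 → A) (hπ : ∀ i, π i ∈ P) {i₀ i₁ : Fin 2}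
    (hi : i₀ ≠ i₁) (hμ : IsUnit (μ i₀)) :
    Ideal.span (Set.range ![∑ i, (μ i + π i) * t i, t i₁]) = P ∧ IsRsopPart ![∑ i, (μ i + π i) * t i, t i₁] := by
  classical
  set R := ∑ i, (μ i + π i) * t i with hR
  have htmem : ∀ i, t i ∈ P := fun i => by rw [← htP]; exact Ideal.subset_span ⟨i, rfl⟩
  -- `R = A₀ · t i₀ + B · t i₁` with `A₀` a unit
  have huniv : (Finset.univ : Finset (Fin 2)) = {i₀, i₁} := by
    ext i; fin_cases i <;> fin_cases i₀ <;> fin_cases i₁ <;> simp_all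
  have hRsplit : R = (μ i₀ + π i₀) * t i₀ + (μ i₁ + π i₁) * t i₁ := by
    rw [hR, huniv, Finset.sum_pair hi]
  have hA : IsUnit (μ i₀ + π i₀) := by
    by_contra hnu
    have hm : μ i₀ + π i₀ ∈ maximalIdeal A := (mem_maximalIdeal _).mpr hnu
    have : μ i₀ ∈ maximalIdeal A := by
      have h2 := Ideal.sub_mem _ hm (hPm (hπ i₀))
      rwa [add_sub_cancel_right] at h2
    exact (mem_maximalIdeal _).mp this hμ
  have hspan : Ideal.span (Set.range ![R, t i₁]) = P := by
    apply le_antisymm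
    · refine Ideal.span_le.mpr ?_
      rintro _ ⟨l, rfl⟩
      fin_cases l
      · show R ∈ (P : Set A)
        rw [hRsplit]
        exact Ideal.add_mem _ (Ideal.mul_mem_left _ _ (htmem i₀)) (Ideal.mul_mem_left _ _ (htmem i₁))
      · simpa using htmem i₁
    · rw [← htP]
      refine Ideal.span_le.mpr ?_
      rintro _ ⟨i, rfl⟩
      have hRmem : R ∈ Ideal.span (Set.range ![R, t i₁]) := Ideal.subset_span ⟨0, by simp⟩
      have ht1mem : t i₁ ∈ Ideal.span (Set.range ![R, t i₁]) := Ideal.subset_span ⟨1, by simp⟩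
      have ht0mem : t i₀ ∈ Ideal.span (Set.range ![R, t i₁]) := by
        have : t i₀ = ↑(hA.unit⁻¹) * (R - (μ i₁ + π i₁) * t i₁) := by
          rw [hRsplit, add_sub_cancel_right, ← mul_assoc, IsUnit.val_inv_mul, one_mul]
        rw [this]
        exact Ideal.mul_mem_left _ _ (Ideal.sub_mem _ hRmem (Ideal.mul_mem_left _ _ ht1mem))
      by_cases hii : i = i₀
      · subst hii; exact ht0mem
      · have : i = i₁ := by fin_cases i <;> fin_cases i₀ <;> fin_cases i₁ <;> simp_all
        subst this; exact ht1mem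
  exact ⟨hspan, isRsopPart_of_span_eq_span ht htP hspan⟩

/-- **(T2a) of the memo, packaged for the case of no pending transversal component**: a representative
`u₀ · R^a · ∏_i (γ_i w^{k_i} + s₀ᵢ)^{a_i}` with `R = Σ_i (w^j μ_i + π_i) t_i` simple along the curve (`μ_{i₀}` a unit), `p ∤ a`, along ANY chain of
`n ≥ j` and `n ≥ max k_i` point blowing ups following the curve, is clean-permissible for the strict transform at the end point: there `R` reads
`c · e^{j+n} · R⁽ⁿ⁾` with `(R⁽ⁿ⁾, t⁽ⁿ⁾_{i₁})` a generating rsop pair, and the landed `cleanPermissibleAt_of_split` applies with the exponent `a` of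
`R⁽ⁿ⁾` prime to `p`. [cite: CossartJannsenSaito2020, proof of Thm. 6.28, Step 5] [cite: BierstoneGrigorievMilmanWlodarczyk2011, Def. 3.1.3 (2)] -/
theorem cleanPermissibleAt_of_pointChain_simpleContaining {X₀ X : Scheme.{u}} [IsIntegral X₀] [IsIntegral X] {σ : X ⟶ X₀}
    [IsDominant σ] {C₀ : Closeds X₀} {C : Closeds X} {x : X} {n : ℕ} (h : IsPointChainAlong σ C₀ C x n)
    [IsLocallyNoetherian X₀] [IsLocallyNoetherian X] (hX₀ : Scheme.IsRegular X₀)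
    (hC₀reg : ∀ y ∈ (C₀ : Set X₀), ∃ c : Fin 2 → X₀.presheaf.stalk y,
      IsRsopPart c ∧ Ideal.span (Set.range c) = stalkIdeal (vanishingIdeal C₀) y)
    (hxC₀ : σ x ∈ (C₀ : Set X₀)) (hdim₀ : ringKrullDim (X₀.presheaf.stalk (σ x)) = 3)
    (p : ℕ) (G : X₀.functionField) (cc : Fin p → X₀.functionField) (hcc : ∃ j : Fin p, (j : ℕ) ≠ 0 ∧ cc j ≠ 0)
    (w u₀ : X₀.presheaf.stalk (σ x)) (hw : stalkIdeal (vanishingIdeal C₀) (σ x) ⊔ Ideal.span {w} = maximalIdeal _)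
    (hu₀ : IsUnit u₀) (t : Fin 2 → X₀.presheaf.stalk (σ x)) (ht : IsRsopPart t)
    (htP : Ideal.span (Set.range t) = stalkIdeal (vanishingIdeal C₀) (σ x))
    (j : ℕ) (μ π : Fin 2 → X₀.presheaf.stalk (σ x)) (hπ : ∀ i, π i ∈ stalkIdeal (vanishingIdeal C₀) (σ x))
    {i₀ i₁ : Fin 2} (hi : i₀ ≠ i₁) (hμ : IsUnit (μ i₀)) (a : ℕ) (ha : ¬ p ∣ a) (hjn : j ≤ n)
    {m : ℕ} (γ s₀ : Fin m → X₀.presheaf.stalk (σ x)) (hγ : ∀ i, IsUnit (γ i))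
    (hs₀ : ∀ i, s₀ i ∈ stalkIdeal (vanishingIdeal C₀) (σ x)) (k b : Fin m → ℕ) (hkn : ∀ i, k i ≤ n)
    (hX : (∑ l : Fin p, cc l ^ p * G ^ (l : ℕ)) =
      RatFn.toFunctionField (σ x) (u₀ * (∑ i, (w ^ j * μ i + π i) * t i) ^ a * ∏ i, (γ i * w ^ k i + s₀ i) ^ b i)) :
    CleanPermissibleAt p (RatFn.toFunctionField x) (RatFn.functionFieldMap σ G) (stalkIdeal (vanishingIdeal C) x) := by
  classical
  -- the simple containing representative, the pair and the transversal family along the chain (ONE exceptional coordinate `e`)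
  obtain ⟨hXreg, hCreg, hxC, hdim, e, he, hfam, tn, htn, htnP, -, c, μ', π', hc, hμ', hπ', hRimg⟩ :=
    simpleContaining_pair_along_pointChain h hX₀ hC₀reg hxC₀ hdim₀ w hw t ht htP j μ π hπ γ s₀ hγ hs₀ k
  haveI : IsRegularLocalRing (X.presheaf.stalk x) := hXreg x
  haveI : IsRegularLocalRing (X.presheaf.stalk x ⧸ stalkIdeal (vanishingIdeal C) x) := by
    rw [← htnP]; exact htn.isRegularLocalRing_quotient
  have hP1 : ringKrullDim (X.presheaf.stalk x ⧸ stalkIdeal (vanishingIdeal C) x) = 1 := by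
    rw [← htnP]; exact ringKrullDim_quotient_span_pair_eq_one htn hdim
  have hPle : stalkIdeal (vanishingIdeal C) x ≤ maximalIdeal _ := le_sup_left.trans he.le
  have hem : e ∈ maximalIdeal (X.presheaf.stalk x) := he.le (Ideal.mem_sup_right (Ideal.mem_span_singleton_self e))
  -- saturation: `R⁽ⁿ⁾` and `t⁽ⁿ⁾_{i₁}` form a generating rsop pair
  set Rn : X.presheaf.stalk x := ∑ i, (μ' i + π' i) * tn i with hRn
  have hRn' : (∑ i, (e ^ (j - n) * μ' i + π' i) * tn i) = Rn := by
    rw [hRn]; exact Finset.sum_congr rfl fun i _ => by rw [Nat.sub_eq_zero_of_le hjn, pow_zero, one_mul]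
  obtain ⟨hpairP, hpair⟩ := span_pair_eq_of_unit_coeff htn htnP hPle μ' π' hπ' hi (hμ' i₀ hμ)
  -- per transversal member: `σ^#(s_i) = W_i · e^{k_i}` with `W_i` a unit
  choose cf γf πf hcf hγf hπf hsf using hfam
  have hW : ∀ i, IsUnit (cf i * (γf i + πf i)) := by
    intro i
    refine (hcf i).mul ?_
    by_contra hnu
    have hm : γf i + πf i ∈ maximalIdeal (X.presheaf.stalk x) := (mem_maximalIdeal _).mpr hnu
    have h2 : γf i + πf i - πf i ∈ maximalIdeal (X.presheaf.stalk x) := Ideal.sub_mem _ hm (hPle (hπf i))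
    rw [add_sub_cancel_right] at h2
    exact (mem_maximalIdeal _).mp h2 (hγf i)
  have hsf' : ∀ i, (σ.stalkMap x).hom (γ i * w ^ k i + s₀ i) = (cf i * (γf i + πf i)) * e ^ k i := by
    intro i
    rw [hsf i, Nat.min_eq_right (hkn i), Nat.sub_eq_zero_of_le (hkn i), pow_zero, mul_one]
    ring
  -- the exponent of `e` on `R`, and the unit `U`
  have hexp : 2 * min n j + (n - j) = j + n := by rw [Nat.min_eq_right hjn]; omega
  set N : ℕ := (j + n) * a + ∑ i, k i * b i with hN
  set U : X.presheaf.stalk x := (σ.stalkMap x).hom u₀ * c ^ a * ∏ i, (cf i * (γf i + πf i)) ^ b i with hU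
  have hUunit : IsUnit U := ((hu₀.map _).mul (hc.pow _)).mul (IsUnit.prod_univ_iff.mpr fun i => (hW i).pow _)
  have himg : (σ.stalkMap x).hom (u₀ * (∑ i, (w ^ j * μ i + π i) * t i) ^ a * ∏ i, (γ i * w ^ k i + s₀ i) ^ b i) =
      U * Rn ^ a * e ^ N := by
    rw [map_mul, map_mul, map_pow, hRimg, hRn', hexp, map_prod]
    simp only [map_pow, hsf', mul_pow, ← pow_mul, Finset.prod_mul_distrib, Finset.prod_pow_eq_pow_sum, hU, hN, pow_add]
    ring
  have hX' : (∑ l : Fin p, (RatFn.functionFieldMap σ (cc l)) ^ p * (RatFn.functionFieldMap σ G) ^ (l : ℕ)) =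
      RatFn.toFunctionField x (U * (∏ l : Fin 2, (![Rn, tn i₁] : Fin 2 → _) l ^ (![a, 0] : Fin 2 → ℕ) l) *
        ∏ l : Fin 1, (![e] : Fin 1 → _) l ^ (![N] : Fin 1 → ℕ) l) := by
    calc (∑ l : Fin p, (RatFn.functionFieldMap σ (cc l)) ^ p * (RatFn.functionFieldMap σ G) ^ (l : ℕ))
        = RatFn.functionFieldMap σ (∑ l : Fin p, cc l ^ p * G ^ (l : ℕ)) := by
          rw [map_sum]; simp only [map_mul, map_pow]
      _ = RatFn.functionFieldMap σ (RatFn.toFunctionField (σ x)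
            (u₀ * (∑ i, (w ^ j * μ i + π i) * t i) ^ a * ∏ i, (γ i * w ^ k i + s₀ i) ^ b i)) := by rw [hX]
      _ = RatFn.toFunctionField x ((σ.stalkMap x)
            (u₀ * (∑ i, (w ^ j * μ i + π i) * t i) ^ a * ∏ i, (γ i * w ^ k i + s₀ i) ^ b i)) :=
          RatFn.functionFieldMap_toFunctionField σ x _
      _ = RatFn.toFunctionField x (U * Rn ^ a * e ^ N) := congrArg (RatFn.toFunctionField x) himg
      _ = _ := by simp
  have hcc' : ∃ l : Fin p, (l : ℕ) ≠ 0 ∧ RatFn.functionFieldMap σ (cc l) ≠ 0 := by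
    obtain ⟨l, hl, hl0⟩ := hcc
    exact ⟨l, hl, fun h0 => hl0 ((RatFn.functionFieldMap σ).injective (by rw [h0, map_zero]))⟩
  have haJ : ∀ l, (![Rn, tn i₁] : Fin 2 → _) l ∈ stalkIdeal (vanishingIdeal C) x := fun l => by
    rw [← hpairP]; exact Ideal.subset_span ⟨l, rfl⟩
  have hb := isRsopPart_quotient_singleton_of_sup_span_eq (stalkIdeal (vanishingIdeal C) x) hP1 e he
  refine cleanPermissibleAt_of_split p (RatFn.toFunctionField x) (RatFn.functionFieldMap σ G) _ _ hcc' ![Rn, tn i₁] ![e] hpair haJ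
    (fun l => ?_) hb ![a, 0] ![N] (Or.inl ⟨0, by simpa using ha⟩) U hUunit hX'
  fin_cases l; simpa using hem

end Summit.ResolutionOfSingularities.ResolutionOfSingularities.Theorems.RadicialJung.CleanModels

end
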